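import Literature.MathematicalPhysics.QuantumLattice.HubbardLangerMattisTorus
import Literature.MathematicalPhysics.QuantumLattice.HubbardChainEnergyDensity
import HarnessLib

/-!
# The Langer–Mattis lower bound for the half-filled Hubbard chain in the thermodynamic limit

Topic `MathematicalPhysics/QuantumLattice`, family `hubbard`. Third piece of the Langer–Mattis /
Kennedy–Lieb development (`HubbardLangerMattisBound.lean`: every finite bipartite graph;
`HubbardLangerMattisTorus.lean`: even tori `(ℤ/Lℤ)^d` with explicit plane-wave levels and the
two-dimensional thermodynamic limit `energyDensity2D`). Here the one-dimensional thermodynamic limit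
of the tree, the half-filled ring energy density `ThermodynamicLimit.hubbardChainEnergyDensity t U =
lim_L E_L(L)/L` (`HubbardChainEnergyDensity.lean`), is bounded below — PROVED:

  `hubbardChainEnergyDensity t U ≥ U/4 - (2π)⁻¹ ∫_{[-π,π]} √(4t² cos² p + U²/16) dp`   (`U ≥ 0`),

Langer–Mattis' lower curve "H.F.(1, U/2)" of their Fig. 1 (the 1D comparison with the exact Lieb–Wu
energy) [LangerMattis1971, eqs. (3)–(5), Fig. 1]: `hubbardChainEnergyDensity_ge`. The integral is
written over the tree's Brillouin zone `brillouin 1 ⊆ (Fin 1 → ℝ)` with the integrand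
`LangerMattis.lmIntegrand t U p = √((2t Σ_i cos p_i)² + U²/16)` of part 2. Proof: the even rings
`L = 2m` are bipartite tori with `d = 1`, so `hubbardTorus_groundEnergyAt_ge` gives
`E_L(L)/L ≥ U/4 - L⁻¹ Σ_k √(4t²cos²(2πk/L) + U²/16)`; the momentum average is a corner Riemann sum
(`sum_latticeMomentum_div_eq_cornerRiemannSum`) converging to `(2π)⁻¹ ∫` (`tendsto_cornerRiemannSum`),
and `E_{2m}(2m)/(2m) → e` (`tendsto_hubbardChainEnergyDensity_even`). Under the tree's named fact
`lieb_wu` this is Langer–Mattis' Fig. 1 comparison `liebWuEnergy U ≥ U/4 - (2π)⁻¹∫…`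
(`liebWuEnergy_ge_langerMattis`, conditional on `lieb_wu` exactly like
`hubbardChainEnergyDensity_eq_liebWuEnergy`).

## References

* W. D. Langer, D. C. Mattis, Phys. Lett. 36A (1971) 139–140, eqs. (3)–(5) and Fig. 1.
  [LangerMattis1971]
* T. Kennedy, E. H. Lieb, Physica A 138 (1986) 320–358, Theorem 2.1. [KennedyLieb1986]

## Mathlib / tree search

Tree (REUSED): `LangerMattis.hubbardTorus_groundEnergyAt_ge`, `LangerMattis.lmIntegrand`,
`continuous_lmIntegrand`, `lmIntegrand_add_pi`, `sum_latticeMomentum_div_eq_cornerRiemannSum` (part 2),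
`ThermodynamicLimit.hubbardChainEnergyDensity`, `tendsto_hubbardChainEnergyDensity_even`,
`energyPerSite_fermionTorusGraph_one`, `tendsto_cornerRiemannSum`. Mathlib: `tendsto_add_atTop_nat`,
`le_of_tendsto_of_tendsto`.
-/

noncomputable section

namespace Literature.MathematicalPhysics.QuantumLattice

namespace LangerMattis

open Filter Finset Literature.Probability.LatticeModels ThermodynamicLimit
open scoped Topology

/-- **Langer–Mattis for the half-filled chain in the thermodynamic limit.** For `U ≥ 0` and any
real `t`,

  `hubbardChainEnergyDensity t U ≥ U/4 - (2π)⁻¹ ∫_{[-π,π]} √((2t cos p)² + U²/16) dp`,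

the lower bound `E_A(U/2, 1)` of Langer–Mattis, Phys. Lett. 36A (1971) 139, eqs. (3)–(5) (their
Fig. 1 compares it with the exact Lieb–Wu energy), with the configuration minimum supplied by
Kennedy–Lieb, Physica A 138 (1986) 320, Theorem 2.1. (`U ≥ 0` enters only through the existence of
the limit defining `hubbardChainEnergyDensity`.)
[cite: LangerMattis1971, eqs. (3)–(5)][cite: KennedyLieb1986, Theorem 2.1] -/
theorem hubbardChainEnergyDensity_ge (t : ℝ) {U : ℝ} (hU : 0 ≤ U) :
    U / 4 - (2 * Real.pi)⁻¹ * ∫ p in brillouin 1, lmIntegrand t U p ≤ hubbardChainEnergyDensity t U := by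
  -- the even rings `L = 2(m+2)`
  set φ : ℕ → ℕ := fun m => 2 * (m + 2) with hφdef
  have hφ : Tendsto φ atTop atTop :=
    tendsto_atTop_atTop.2 fun b => ⟨b, fun m hm => by simp only [hφdef]; omega⟩
  have hlim : Tendsto (fun m => energyPerSite (fermionTorusGraph 1 (φ m)) t U (φ m)) atTop
      (𝓝 (hubbardChainEnergyDensity t U)) :=
    (tendsto_hubbardChainEnergyDensity_even t hU).comp (tendsto_add_atTop_nat 2)
  -- the lower bounds converge to the Langer–Mattis constant
  have hF : ContinuousOn (lmIntegrand (d := 1) t U) (brillouin 1) :=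
    (continuous_lmIntegrand t U).continuousOn
  have hRS : Tendsto (fun m => (2 * Real.pi)⁻¹ * cornerRiemannSum (lmIntegrand (d := 1) t U) (φ m))
      atTop (𝓝 ((2 * Real.pi)⁻¹ * ∫ p in brillouin 1, lmIntegrand t U p)) :=
    ((tendsto_cornerRiemannSum hF).comp hφ).const_mul _
  have hb : Tendsto (fun m => U / 4 - (2 * Real.pi)⁻¹ * cornerRiemannSum (lmIntegrand (d := 1) t U) (φ m))
      atTop (𝓝 (U / 4 - (2 * Real.pi)⁻¹ * ∫ p in brillouin 1, lmIntegrand t U p)) :=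
    tendsto_const_nhds.sub hRS
  refine le_of_tendsto_of_tendsto hb hlim (Eventually.of_forall fun m => ?_)
  -- the finite-volume inequality on the ring of length `L = 2(m+2)`, divided by `L`
  dsimp only
  have hL3 : 3 ≤ φ m := by simp only [hφdef]; omega
  haveI : NeZero (φ m) := ⟨by omega⟩
  have hLpos : (0 : ℝ) < ((φ m : ℕ) : ℝ) := by exact_mod_cast (show 0 < φ m by omega)
  have hNle : φ m ≤ 2 * φ m ^ 1 := by rw [pow_one]; omega
  have h : U / 2 * ((φ m : ℕ) : ℝ) - (U / 4 * ((φ m : ℕ) : ℝ) ^ 1 +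
      ∑ k : TorusSite 1 (φ m), lmIntegrand t U (latticeMomentum (φ m) k)) ≤
      groundEnergyAt (fermionTorusGraph 1 (φ m)) t U (φ m) :=
    hubbardTorus_groundEnergyAt_ge (d := 1) (even_two_mul _) hL3 t U hNle
  have havg := sum_latticeMomentum_div_eq_cornerRiemannSum (d := 1) (L := φ m) (lmIntegrand t U)
    (lmIntegrand_add_pi t U)
  rw [pow_one, pow_one] at havg
  rw [← havg, energyPerSite_fermionTorusGraph_one, le_div_iff₀ hLpos]
  have key : (U / 4 - (∑ k : TorusSite 1 (φ m), lmIntegrand t U (latticeMomentum (φ m) k)) /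
      ((φ m : ℕ) : ℝ)) * ((φ m : ℕ) : ℝ) =
      U / 2 * ((φ m : ℕ) : ℝ) - (U / 4 * ((φ m : ℕ) : ℝ) ^ 1 +
        ∑ k : TorusSite 1 (φ m), lmIntegrand t U (latticeMomentum (φ m) k)) := by
    field_simp
    ring
  rw [key]
  exact h

/-- **Langer–Mattis' Fig. 1 as an inequality**: assuming the announced Lieb–Wu limit (`lieb_wu`, the
tree's named fact for the half-filled chain energy density, `t = 1`), the exact energy per site lies
above the Langer–Mattis lower curve:
`liebWuEnergy U ≥ U/4 - (2π)⁻¹ ∫_{[-π,π]} √(4cos² p + U²/16) dp` for `U > 0`.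
[cite: LangerMattis1971, Fig. 1 and eqs. (3)–(5)] -/
theorem liebWuEnergy_ge_langerMattis (hlw : lieb_wu) {U : ℝ} (hU : 0 < U) :
    U / 4 - (2 * Real.pi)⁻¹ * ∫ p in brillouin 1, lmIntegrand 1 U p ≤
      Literature.Analysis.FunctionSpaces.liebWuEnergy U := by
  rw [← hubbardChainEnergyDensity_eq_liebWuEnergy hlw hU]
  exact hubbardChainEnergyDensity_ge 1 hU.le

end LangerMattis

end Literature.MathematicalPhysics.QuantumLattice
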